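import Summits.CriticalPhenomena.PercolationContinuityZ3.Theorems.PercNearOneGluingNoHeavyLowerTailSuperTerminalDownsets
import Summits.CriticalPhenomena.PercolationContinuityZ3.Theorems.PercNearOneGluingNoHeavyLowerTailSuperTerminalDownsetEvents
import Summits.CriticalPhenomena.PercolationContinuityZ3.Theorems.PercNearOneGluingNoHeavyLowerTailSuperTerminalP3HalfStable
import HarnessLib

/-!
# `P3½` on a finite weighted graph follows from `P3½` on its `{s,a,b,c}`-pieces (graph-level assembly of THEOREM C)

Support file for crux `stmt-CriticalPhenomena-4575` (`NoHeavyLowerTail`), seat `prim-l12-p1` gen 32 (`--supports stmt-CriticalPhenomena-4575`);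
graph-level assembly of the `∥`-stability theorems (lead gen 134 spec `run/shared/lean/prim/prim-nh-lead-4575/GRAPH-LEVEL-SPEC-g134.md`),
part 3 of 3 (part 1: `…SuperTerminalDownsets`, part 2: `…SuperTerminalDownsetEvents`).  No definitions, no sorries, standard axioms.

THE ROW.  Bond percolation `μ = prodBernoulli w` on a finite vertex type `V`, pairwise distinct terminals `s a b c`;
`F = {s↔a} ∩ {s↮b}`, `I = c ∤ {s,a,b} = {c↮s}∩{c↮a}∩{c↮b}`.  The reverse-Harris FACE ROW `P3½` is
`μ(F)·μ(c ↔ {s,a,b}) ≤ 2·μ(F ∩ c ↔ {s,a,b})` (`SuperTerminalQuarticFace`: the face of `V4`; ⟹ `TCB` ⟹ `TT-CHORD(E₃)`).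

MAIN THEOREM (`p3half_of_pieces`).  Let `part : V → ι` be a splitting of `w` along `T₄ = {s,a,b,c}` (every pair of non-terminals with
different labels has weight `0`; e.g. the connected components of `G − T₄`).  **If `P3½` holds for every piece as a weighted graph of its own
(`wᵢ := w` on the pairs of piece `i`, `0` elsewhere — same vertex type), then `P3½` holds for `w`.**  Hence a counterexample to `P3½` with the
fewest internal vertices is `{s,a,b,c}`-PRIME (one piece, no terminal–terminal edges): "`P3½` on all finite weighted graphs ⟺ `P3½` on primes".

PROOF = lead gen 134's THEOREM C at the graph level:
(1) `goodP3_of_p3half`: for EVERY weight `u`, the down-set vector `(d0,…,d7)(u)` (`dk = P_u` of the eight principal down-sets of the partition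
    lattice of `T₄`, part 1) satisfies the order relations (part 2 `order_relations`), the tropical law `(T)` `d1⁴ ≤ d2²d4²d7` (part 1
    `quartic_law`, from `isoQuartic_graph` of the `sa`-glued graph), and — iff `P3½(u)` — the row in down-set coordinates (part 2 `real_F`, …);
(2) `goodP3_prod`: such "good" vectors are closed under coordinatewise products (`SuperTerminalP3HalfStable.dvec_p3half_mul`, by induction);
(3) the splitting formula `PartitionGluing.real_partLE_eq_terminalPiece_mul_prod` [BeicheltTittmann2012, Thm. 7.5]: `dk(w) = dk(w₀)·∏ᵢ dk(wᵢ)`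
    with `w₀` the terminal piece, which is good by (2) applied pair by pair (`goodP3_single`: a one-pair graph satisfies `P3½` trivially;
    `goodP3_terminal`).
-/

namespace Summit.CriticalPhenomena.PercolationContinuityZ3.Theorems.SuperTerminalP3HalfGluing

open MeasureTheory Set
open Literature.Probability.Percolation Literature.Probability.Percolation.PartitionGluing
open Literature.Probability.LatticeModels (prodBernoulli)
open SuperTerminalDownsets SuperTerminalDownsetEvents SuperTerminalP3HalfStable
open scoped Classical

variable {V : Type*} [Fintype V]

/-- `P3½`-GOODNESS of a down-set vector `(x0,…,x7) = (D(s|a|b|c), D(sa|b|c), D(sa|bc), D(s|a|bc), D(sac|b), D(sc|a|b), D(ac|s|b), D(c|sab))`: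
the order relations of a partition law, the row `P3½` in down-set coordinates, and the tropical law `(T)` — literally the hypothesis list
(and the conclusion) of `SuperTerminalP3HalfStable.dvec_p3half_mul`.  Local notation only. -/
local notation "GoodP3[" x0 "," x1 "," x2 "," x3 "," x4 "," x5 "," x6 "," x7 "]" =>
  ((((0 : ℝ) ≤ x0 ∧ x0 ≤ x1 ∧ x0 ≤ x3 ∧ x0 ≤ x5 ∧ x0 ≤ x6 ∧ (0 : ℝ) ≤ x7 ∧ x7 ≤ 1 ∧
        (0 : ℝ) ≤ x2 - x3 - x1 + x0 ∧ (0 : ℝ) ≤ x4 - x5 - x6 + x0 - x1 + x0) ∧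
      (x2 - x3 + x4 - x5 - x6 - x1 + 2 * x0) * (1 - x7) ≤ 2 * (x2 - x3 + x4 - x5 - x6 - 2 * x1 + 3 * x0) ∧
      x1 ^ 4 ≤ x2 ^ 2 * x4 ^ 2 * x7) : Prop)

/-- **Good vectors are closed under coordinatewise products** (induction on `SuperTerminalP3HalfStable.dvec_p3half_mul`). [this work] -/
theorem goodP3_prod {ι : Type*} (S : Finset ι) {x0 x1 x2 x3 x4 x5 x6 x7 : ℝ} {y0 y1 y2 y3 y4 y5 y6 y7 : ι → ℝ}
    (hx : GoodP3[x0, x1, x2, x3, x4, x5, x6, x7])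
    (hy : ∀ i ∈ S, GoodP3[y0 i, y1 i, y2 i, y3 i, y4 i, y5 i, y6 i, y7 i]) :
    GoodP3[x0 * ∏ i ∈ S, y0 i, x1 * ∏ i ∈ S, y1 i, x2 * ∏ i ∈ S, y2 i, x3 * ∏ i ∈ S, y3 i,
      x4 * ∏ i ∈ S, y4 i, x5 * ∏ i ∈ S, y5 i, x6 * ∏ i ∈ S, y6 i, x7 * ∏ i ∈ S, y7 i] := by
  induction S using Finset.induction_on with
  | empty => simpa only [Finset.prod_empty, mul_one] using hx
  | @insert j S hj ih =>
    obtain ⟨⟨h0, h1, h3, h5, h6, h7, h71, hζ, hτ⟩, hP, hT⟩ := ih fun i hi => hy i (Finset.mem_insert_of_mem hi)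
    obtain ⟨⟨g0, g1, g3, g5, g6, g7, g71, gζ, gτ⟩, gP, gT⟩ := hy j (Finset.mem_insert_self j S)
    have key := dvec_p3half_mul h0 h1 h3 h5 h6 h7 h71 hζ hτ hP hT g0 g1 g3 g5 g6 g7 g71 gζ gτ gP gT
    have r : ∀ (x : ℝ) (y : ι → ℝ), x * ∏ i ∈ insert j S, y i = x * (∏ i ∈ S, y i) * y j := fun x y => by
      rw [Finset.prod_insert hj]; ring
    rw [r x0 y0, r x1 y1, r x2 y2, r x3 y3, r x4 y4, r x5 y5, r x6 y6, r x7 y7]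
    exact key

section Pieces
variable {s a b c : V}

/-- **Every weighted graph satisfying `P3½` has a good down-set vector**: the order relations and `(T)` hold for every weight (parts 1–2),
and `P3½` is the row in down-set coordinates. [this work] -/
theorem goodP3_of_p3half (u : Sym2 V → unitInterval) (hd : s ≠ a ∧ s ≠ b ∧ s ≠ c ∧ a ≠ b ∧ a ≠ c ∧ b ≠ c)
    (hP3 : (prodBernoulli u).real (openConn s a ∩ (openConn s b)ᶜ : Set (BondConfig V)) *
        (prodBernoulli u).real ((openConn c s)ᶜ ∩ (openConn c a)ᶜ ∩ (openConn c b)ᶜ : Set (BondConfig V))ᶜ ≤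
      2 * (prodBernoulli u).real (openConn s a ∩ (openConn s b)ᶜ ∩ ((openConn c s)ᶜ ∩ (openConn c a)ᶜ ∩ (openConn c b)ᶜ)ᶜ : Set (BondConfig V))) :
    GoodP3[(prodBernoulli u).real ((openConn s a)ᶜ ∩ (openConn s b)ᶜ ∩ (openConn s c)ᶜ ∩ (openConn a b)ᶜ ∩ (openConn a c)ᶜ ∩ (openConn b c)ᶜ),
      (prodBernoulli u).real ((openConn s b)ᶜ ∩ (openConn s c)ᶜ ∩ (openConn a b)ᶜ ∩ (openConn a c)ᶜ ∩ (openConn b c)ᶜ),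
      (prodBernoulli u).real ((openConn s b)ᶜ ∩ (openConn s c)ᶜ ∩ (openConn a b)ᶜ ∩ (openConn a c)ᶜ),
      (prodBernoulli u).real ((openConn s a)ᶜ ∩ (openConn s b)ᶜ ∩ (openConn s c)ᶜ ∩ (openConn a b)ᶜ ∩ (openConn a c)ᶜ),
      (prodBernoulli u).real ((openConn s b)ᶜ ∩ (openConn a b)ᶜ ∩ (openConn b c)ᶜ),
      (prodBernoulli u).real ((openConn s a)ᶜ ∩ (openConn s b)ᶜ ∩ (openConn a b)ᶜ ∩ (openConn a c)ᶜ ∩ (openConn b c)ᶜ),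
      (prodBernoulli u).real ((openConn s a)ᶜ ∩ (openConn s b)ᶜ ∩ (openConn s c)ᶜ ∩ (openConn a b)ᶜ ∩ (openConn b c)ᶜ),
      (prodBernoulli u).real ((openConn c s)ᶜ ∩ (openConn c a)ᶜ ∩ (openConn c b)ᶜ)] := by
  obtain ⟨o1, o3, o5, o6, o71, oζ, oτ⟩ := order_relations u s a b c
  refine ⟨⟨measureReal_nonneg, o1, o3, o5, o6, measureReal_nonneg, o71, oζ, oτ⟩, ?_, quartic_law u hd⟩
  rw [real_F u s a b c, real_F_inter_conn u s a b c, real_conn u s a b c] at hP3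
  linear_combination hP3

/-- **A one-pair graph is good**: for the weight `u = w·1_{e}` supported on a single pair `e`, `P3½` holds trivially — if `e = s(s,a)` the port
`c` is almost surely isolated (`μ(c ↔ T) = 0`), otherwise `μ(F) ≤ μ(s ↔ a) = 0` (part 2 `real_openConn_eq_zero_of_single`). [this work] -/
theorem goodP3_single (w : Sym2 V → unitInterval) (hd : s ≠ a ∧ s ≠ b ∧ s ≠ c ∧ a ≠ b ∧ a ≠ c ∧ b ≠ c) (e : Sym2 V) :
    GoodP3[(prodBernoulli fun e' => if e' = e then w e' else 0).real
        ((openConn s a)ᶜ ∩ (openConn s b)ᶜ ∩ (openConn s c)ᶜ ∩ (openConn a b)ᶜ ∩ (openConn a c)ᶜ ∩ (openConn b c)ᶜ),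
      (prodBernoulli fun e' => if e' = e then w e' else 0).real
        ((openConn s b)ᶜ ∩ (openConn s c)ᶜ ∩ (openConn a b)ᶜ ∩ (openConn a c)ᶜ ∩ (openConn b c)ᶜ),
      (prodBernoulli fun e' => if e' = e then w e' else 0).real ((openConn s b)ᶜ ∩ (openConn s c)ᶜ ∩ (openConn a b)ᶜ ∩ (openConn a c)ᶜ),
      (prodBernoulli fun e' => if e' = e then w e' else 0).real
        ((openConn s a)ᶜ ∩ (openConn s b)ᶜ ∩ (openConn s c)ᶜ ∩ (openConn a b)ᶜ ∩ (openConn a c)ᶜ),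
      (prodBernoulli fun e' => if e' = e then w e' else 0).real ((openConn s b)ᶜ ∩ (openConn a b)ᶜ ∩ (openConn b c)ᶜ),
      (prodBernoulli fun e' => if e' = e then w e' else 0).real
        ((openConn s a)ᶜ ∩ (openConn s b)ᶜ ∩ (openConn a b)ᶜ ∩ (openConn a c)ᶜ ∩ (openConn b c)ᶜ),
      (prodBernoulli fun e' => if e' = e then w e' else 0).real
        ((openConn s a)ᶜ ∩ (openConn s b)ᶜ ∩ (openConn s c)ᶜ ∩ (openConn a b)ᶜ ∩ (openConn b c)ᶜ),
      (prodBernoulli fun e' => if e' = e then w e' else 0).real ((openConn c s)ᶜ ∩ (openConn c a)ᶜ ∩ (openConn c b)ᶜ)] := by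
  refine goodP3_of_p3half _ hd ?_
  set u : Sym2 V → unitInterval := fun e' => if e' = e then w e' else 0 with hu_def
  have hu : ∀ e', e' ≠ e → (u e' : ℝ) = 0 := fun e' h => by simp [hu_def, h]
  have hnn : 0 ≤ 2 * (prodBernoulli u).real
      (openConn s a ∩ (openConn s b)ᶜ ∩ ((openConn c s)ᶜ ∩ (openConn c a)ᶜ ∩ (openConn c b)ᶜ)ᶜ : Set (BondConfig V)) :=
    mul_nonneg zero_le_two measureReal_nonneg
  by_cases hsa : s(s, a) = e
  · -- the port is a.s. isolated: `μ(c ↔ T) ≤ μ(c↔s) + μ(c↔a) + μ(c↔b) = 0`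
    have hcs : (prodBernoulli u).real (openConn c s) = 0 :=
      real_openConn_eq_zero_of_single u e hu (Ne.symm hd.2.2.1) (by
        rw [← hsa]; intro h
        rcases Sym2.eq_iff.1 h with ⟨h1, -⟩ | ⟨h1, -⟩
        · exact hd.2.2.1 h1.symm
        · exact hd.2.2.2.2.1 h1.symm)
    have hca : (prodBernoulli u).real (openConn c a) = 0 :=
      real_openConn_eq_zero_of_single u e hu (Ne.symm hd.2.2.2.2.1) (by
        rw [← hsa]; intro h
        rcases Sym2.eq_iff.1 h with ⟨h1, -⟩ | ⟨h1, h2⟩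
        · exact hd.2.2.1 h1.symm
        · exact hd.1 h2.symm)
    have hcb : (prodBernoulli u).real (openConn c b) = 0 :=
      real_openConn_eq_zero_of_single u e hu (Ne.symm hd.2.2.2.2.2) (by
        rw [← hsa]; intro h
        rcases Sym2.eq_iff.1 h with ⟨h1, -⟩ | ⟨-, h2⟩
        · exact hd.2.2.1 h1.symm
        · exact hd.2.1 h2.symm)
    have hI : (prodBernoulli u).real ((openConn c s)ᶜ ∩ (openConn c a)ᶜ ∩ (openConn c b)ᶜ : Set (BondConfig V))ᶜ = 0 := by
      refine le_antisymm ?_ measureReal_nonneg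
      have hsub : ((openConn c s)ᶜ ∩ (openConn c a)ᶜ ∩ (openConn c b)ᶜ : Set (BondConfig V))ᶜ ⊆
          (openConn c s ∪ openConn c a) ∪ openConn c b := by
        intro ω hω
        simp only [mem_compl_iff, mem_inter_iff, not_and, not_not, mem_union] at hω ⊢
        tauto
      calc (prodBernoulli u).real ((openConn c s)ᶜ ∩ (openConn c a)ᶜ ∩ (openConn c b)ᶜ : Set (BondConfig V))ᶜ
          ≤ (prodBernoulli u).real ((openConn c s ∪ openConn c a) ∪ openConn c b) := measureReal_mono hsub
        _ ≤ (prodBernoulli u).real (openConn c s ∪ openConn c a) + (prodBernoulli u).real (openConn c b) := measureReal_union_le _ _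
        _ ≤ (prodBernoulli u).real (openConn c s) + (prodBernoulli u).real (openConn c a) + (prodBernoulli u).real (openConn c b) :=
            add_le_add (measureReal_union_le _ _) le_rfl
        _ = 0 := by rw [hcs, hca, hcb]; ring
    rw [hI, mul_zero]
    exact hnn
  · -- `μ(F) ≤ μ(s ↔ a) = 0`
    have hF : (prodBernoulli u).real (openConn s a ∩ (openConn s b)ᶜ : Set (BondConfig V)) = 0 :=
      le_antisymm ((measureReal_mono inter_subset_left).trans
        (real_openConn_eq_zero_of_single u e hu hd.1 hsa).le) measureReal_nonneg
    rw [hF, zero_mul]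
    exact hnn

/-- **The terminal piece is good**: for `w₀ := w·1_{pairs of T₄}` (the graph `G⁰ = (T₄, terminal pairs)`), the down-set vector is good —
by induction over the terminal pairs, multiplying one-pair vectors (`goodP3_single`, part 2 `real_partLE_terminal_mul`, `dvec_p3half_mul`).
[this work] -/
theorem goodP3_terminal (w : Sym2 V → unitInterval) (hd : s ≠ a ∧ s ≠ b ∧ s ≠ c ∧ a ≠ b ∧ a ≠ c ∧ b ≠ c) :
    GoodP3[(prodBernoulli fun e => if e ∈ ({s, a, b, c} : Finset V).sym2 then w e else 0).real
        ((openConn s a)ᶜ ∩ (openConn s b)ᶜ ∩ (openConn s c)ᶜ ∩ (openConn a b)ᶜ ∩ (openConn a c)ᶜ ∩ (openConn b c)ᶜ),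
      (prodBernoulli fun e => if e ∈ ({s, a, b, c} : Finset V).sym2 then w e else 0).real
        ((openConn s b)ᶜ ∩ (openConn s c)ᶜ ∩ (openConn a b)ᶜ ∩ (openConn a c)ᶜ ∩ (openConn b c)ᶜ),
      (prodBernoulli fun e => if e ∈ ({s, a, b, c} : Finset V).sym2 then w e else 0).real
        ((openConn s b)ᶜ ∩ (openConn s c)ᶜ ∩ (openConn a b)ᶜ ∩ (openConn a c)ᶜ),
      (prodBernoulli fun e => if e ∈ ({s, a, b, c} : Finset V).sym2 then w e else 0).real
        ((openConn s a)ᶜ ∩ (openConn s b)ᶜ ∩ (openConn s c)ᶜ ∩ (openConn a b)ᶜ ∩ (openConn a c)ᶜ),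
      (prodBernoulli fun e => if e ∈ ({s, a, b, c} : Finset V).sym2 then w e else 0).real
        ((openConn s b)ᶜ ∩ (openConn a b)ᶜ ∩ (openConn b c)ᶜ),
      (prodBernoulli fun e => if e ∈ ({s, a, b, c} : Finset V).sym2 then w e else 0).real
        ((openConn s a)ᶜ ∩ (openConn s b)ᶜ ∩ (openConn a b)ᶜ ∩ (openConn a c)ᶜ ∩ (openConn b c)ᶜ),
      (prodBernoulli fun e => if e ∈ ({s, a, b, c} : Finset V).sym2 then w e else 0).real
        ((openConn s a)ᶜ ∩ (openConn s b)ᶜ ∩ (openConn s c)ᶜ ∩ (openConn a b)ᶜ ∩ (openConn b c)ᶜ),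
      (prodBernoulli fun e => if e ∈ ({s, a, b, c} : Finset V).sym2 then w e else 0).real
        ((openConn c s)ᶜ ∩ (openConn c a)ᶜ ∩ (openConn c b)ᶜ)] := by
  -- induction over sub-finsets `P` of the terminal pairs, for the weights `w·1_P`
  suffices H : ∀ P : Finset (Sym2 V), P ⊆ ({s, a, b, c} : Finset V).sym2 →
      GoodP3[(prodBernoulli fun e => if e ∈ P then w e else 0).real
          ((openConn s a)ᶜ ∩ (openConn s b)ᶜ ∩ (openConn s c)ᶜ ∩ (openConn a b)ᶜ ∩ (openConn a c)ᶜ ∩ (openConn b c)ᶜ),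
        (prodBernoulli fun e => if e ∈ P then w e else 0).real
          ((openConn s b)ᶜ ∩ (openConn s c)ᶜ ∩ (openConn a b)ᶜ ∩ (openConn a c)ᶜ ∩ (openConn b c)ᶜ),
        (prodBernoulli fun e => if e ∈ P then w e else 0).real ((openConn s b)ᶜ ∩ (openConn s c)ᶜ ∩ (openConn a b)ᶜ ∩ (openConn a c)ᶜ),
        (prodBernoulli fun e => if e ∈ P then w e else 0).real
          ((openConn s a)ᶜ ∩ (openConn s b)ᶜ ∩ (openConn s c)ᶜ ∩ (openConn a b)ᶜ ∩ (openConn a c)ᶜ),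
        (prodBernoulli fun e => if e ∈ P then w e else 0).real ((openConn s b)ᶜ ∩ (openConn a b)ᶜ ∩ (openConn b c)ᶜ),
        (prodBernoulli fun e => if e ∈ P then w e else 0).real
          ((openConn s a)ᶜ ∩ (openConn s b)ᶜ ∩ (openConn a b)ᶜ ∩ (openConn a c)ᶜ ∩ (openConn b c)ᶜ),
        (prodBernoulli fun e => if e ∈ P then w e else 0).real
          ((openConn s a)ᶜ ∩ (openConn s b)ᶜ ∩ (openConn s c)ᶜ ∩ (openConn a b)ᶜ ∩ (openConn b c)ᶜ),
        (prodBernoulli fun e => if e ∈ P then w e else 0).real ((openConn c s)ᶜ ∩ (openConn c a)ᶜ ∩ (openConn c b)ᶜ)] from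
    H _ (Finset.Subset.refl _)
  intro P
  induction P using Finset.induction_on with
  | empty =>
    intro _
    have hz : (fun e : Sym2 V => if e ∈ (∅ : Finset (Sym2 V)) then w e else 0) = fun _ => (0 : unitInterval) := by
      funext e; simp
    rw [hz, ← partLE_blk0 hd, ← partLE_blk1 hd, ← partLE_blk2 hd, ← partLE_blk3 hd, ← partLE_blk4 hd, ← partLE_blk5 hd,
      ← partLE_blk6 hd, ← partLE_blk7 hd]
    simp only [real_partLE_zero]
    norm_num
  | @insert e P heP ih =>
    intro hsub
    have heT : e ∈ ({s, a, b, c} : Finset V).sym2 := hsub (Finset.mem_insert_self e P)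
    have hPT : P ⊆ ({s, a, b, c} : Finset V).sym2 := fun x hx => hsub (Finset.mem_insert_of_mem hx)
    have G1 := ih hPT
    have G2 := goodP3_single w hd e
    -- the three weights are terminal-only and `1 − w·1_{P ∪ {e}} = (1 − w·1_P)(1 − w·1_{e})`
    have nt : ∀ x y : V, x ∉ ({s, a, b, c} : Finset V) → s(x, y) ∉ ({s, a, b, c} : Finset V).sym2 := fun x y hx h =>
      hx (Finset.mk_mem_sym2_iff.1 h).1
    have h0 : ∀ x y : V, x ∉ ({s, a, b, c} : Finset V) → x ≠ y →
        (((fun e' : Sym2 V => if e' ∈ P then w e' else 0) s(x, y) : unitInterval) : ℝ) = 0 := by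
      intro x y hx _
      have : s(x, y) ∉ P := fun h => nt x y hx (hPT h)
      simp [this]
    have h0' : ∀ x y : V, x ∉ ({s, a, b, c} : Finset V) → x ≠ y →
        (((fun e' : Sym2 V => if e' = e then w e' else 0) s(x, y) : unitInterval) : ℝ) = 0 := by
      intro x y hx _
      have : s(x, y) ≠ e := fun h => nt x y hx (h ▸ heT)
      simp [this]
    have h0'' : ∀ x y : V, x ∉ ({s, a, b, c} : Finset V) → x ≠ y →
        (((fun e' : Sym2 V => if e' ∈ insert e P then w e' else 0) s(x, y) : unitInterval) : ℝ) = 0 := by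
      intro x y hx _
      have : s(x, y) ∉ insert e P := fun h => nt x y hx (hsub h)
      simp [this]
    have hmul : ∀ e' : Sym2 V, (1 - (((fun e' : Sym2 V => if e' ∈ insert e P then w e' else 0) e' : unitInterval) : ℝ)) =
        (1 - (((fun e' : Sym2 V => if e' ∈ P then w e' else 0) e' : unitInterval) : ℝ)) *
          (1 - (((fun e' : Sym2 V => if e' = e then w e' else 0) e' : unitInterval) : ℝ)) := by
      intro e'
      by_cases h : e' = e
      · subst h; simp [heP]
      · have : (e' ∈ insert e P) = (e' ∈ P) := by rw [Finset.mem_insert]; simp [h]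
        simp [h, this]
    rw [← partLE_blk0 hd, ← partLE_blk1 hd, ← partLE_blk2 hd, ← partLE_blk3 hd, ← partLE_blk4 hd, ← partLE_blk5 hd,
      ← partLE_blk6 hd, ← partLE_blk7 hd] at G1 G2 ⊢
    simp only [real_partLE_terminal_mul _ _ _ _ h0 h0' h0'' hmul]
    obtain ⟨⟨f0, f1, f3, f5, f6, f7, f71, fζ, fτ⟩, fP, fT⟩ := G1
    obtain ⟨⟨g0, g1, g3, g5, g6, g7, g71, gζ, gτ⟩, gP, gT⟩ := G2
    exact dvec_p3half_mul f0 f1 f3 f5 f6 f7 f71 fζ fτ fP fT g0 g1 g3 g5 g6 g7 g71 gζ gτ gP gT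

/-- **MAIN THEOREM (graph-level THEOREM C): `P3½` on a finite weighted graph follows from `P3½` on its `{s,a,b,c}`-pieces.**
Let `s a b c` be pairwise distinct, `part : V → ι` a splitting of `w` along `{s,a,b,c}` (non-terminal pairs across labels have weight `0`),
and suppose every split component — the weighted graph `wᵢ := w·1_{pairs of piece i}` on the same vertex type — satisfies
`μᵢ(F)·μᵢ(c ↔ T) ≤ 2·μᵢ(F ∩ c ↔ T)` (`F = {s↔a}∩{s↮b}`, `T = {s,a,b}`).  Then so does `w`.  In particular a counterexample to `P3½`
(hence to `TCB`, `TT-CHORD(E₃)` via the face route) with the fewest internal vertices is `{s,a,b,c}`-prime. [this work] -/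
theorem p3half_of_pieces {ι : Type*} [Fintype ι] (w : Sym2 V → unitInterval)
    (hd : s ≠ a ∧ s ≠ b ∧ s ≠ c ∧ a ≠ b ∧ a ≠ c ∧ b ≠ c) (part : V → ι)
    (hw : ∀ x y : V, x ∉ ({s, a, b, c} : Finset V) → y ∉ ({s, a, b, c} : Finset V) → part x ≠ part y → (w s(x, y) : ℝ) = 0)
    (hrow : ∀ i : ι,
      (prodBernoulli fun e => if e ∈ piecePairs {s, a, b, c} part i then w e else 0).real
          (openConn s a ∩ (openConn s b)ᶜ : Set (BondConfig V)) *
        (prodBernoulli fun e => if e ∈ piecePairs {s, a, b, c} part i then w e else 0).real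
          ((openConn c s)ᶜ ∩ (openConn c a)ᶜ ∩ (openConn c b)ᶜ : Set (BondConfig V))ᶜ ≤
      2 * (prodBernoulli fun e => if e ∈ piecePairs {s, a, b, c} part i then w e else 0).real
          (openConn s a ∩ (openConn s b)ᶜ ∩ ((openConn c s)ᶜ ∩ (openConn c a)ᶜ ∩ (openConn c b)ᶜ)ᶜ : Set (BondConfig V))) :
    (prodBernoulli w).real (openConn s a ∩ (openConn s b)ᶜ : Set (BondConfig V)) *
        (prodBernoulli w).real ((openConn c s)ᶜ ∩ (openConn c a)ᶜ ∩ (openConn c b)ᶜ : Set (BondConfig V))ᶜ ≤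
      2 * (prodBernoulli w).real (openConn s a ∩ (openConn s b)ᶜ ∩ ((openConn c s)ᶜ ∩ (openConn c a)ᶜ ∩ (openConn c b)ᶜ)ᶜ : Set (BondConfig V)) := by
  have G0 := goodP3_terminal w hd
  have G := fun i => goodP3_of_p3half _ hd (hrow i)
  have key := goodP3_prod (Finset.univ : Finset ι) G0 fun i _ => G i
  -- the splitting formula, coordinate by coordinate
  have S0 := real_partLE_eq_terminalPiece_mul_prod w ({s, a, b, c} : Finset V) part
    (fun v => if v = a then 1 else if v = b then 2 else if v = c then 3 else (0 : ℕ)) hw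
  have S1 := real_partLE_eq_terminalPiece_mul_prod w ({s, a, b, c} : Finset V) part
    (fun v => if v = b then 1 else if v = c then 2 else (0 : ℕ)) hw
  have S2 := real_partLE_eq_terminalPiece_mul_prod w ({s, a, b, c} : Finset V) part
    (fun v => if v = b ∨ v = c then 1 else (0 : ℕ)) hw
  have S3 := real_partLE_eq_terminalPiece_mul_prod w ({s, a, b, c} : Finset V) part
    (fun v => if v = a then 1 else if v = b ∨ v = c then 2 else (0 : ℕ)) hw
  have S4 := real_partLE_eq_terminalPiece_mul_prod w ({s, a, b, c} : Finset V) part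
    (fun v => if v = b then 1 else (0 : ℕ)) hw
  have S5 := real_partLE_eq_terminalPiece_mul_prod w ({s, a, b, c} : Finset V) part
    (fun v => if v = a then 1 else if v = b then 2 else (0 : ℕ)) hw
  have S6 := real_partLE_eq_terminalPiece_mul_prod w ({s, a, b, c} : Finset V) part
    (fun v => if v = a ∨ v = c then 1 else if v = b then 2 else (0 : ℕ)) hw
  have S7 := real_partLE_eq_terminalPiece_mul_prod w ({s, a, b, c} : Finset V) part
    (fun v => if v = c then 1 else (0 : ℕ)) hw
  rw [partLE_blk0 hd] at S0
  rw [partLE_blk1 hd] at S1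
  rw [partLE_blk2 hd] at S2
  rw [partLE_blk3 hd] at S3
  rw [partLE_blk4 hd] at S4
  rw [partLE_blk5 hd] at S5
  rw [partLE_blk6 hd] at S6
  rw [partLE_blk7 hd] at S7
  rw [← S0, ← S1, ← S2, ← S3, ← S4, ← S5, ← S6, ← S7] at key
  obtain ⟨-, hP, -⟩ := key
  rw [real_F w s a b c, real_F_inter_conn w s a b c, real_conn w s a b c]
  linear_combination hP

end Pieces

end Summit.CriticalPhenomena.PercolationContinuityZ3.Theorems.SuperTerminalP3HalfGluing

namespace Summit.CriticalPhenomena.PercolationContinuityZ3.Theorems.SuperTerminalP3HalfGluing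

open MeasureTheory Set
open Literature.Probability.Percolation Literature.Probability.Percolation.PartitionGluing
open Literature.Probability.LatticeModels (prodBernoulli)
open scoped Classical

variable {V : Type*} [Fintype V] {s a b c : V}

/-- **`p3half_of_pieces` with caller-supplied decidability instances** (e.g. `V = Fin n`, `ι = Fin k` or a type of connected components): the same
statement, the instances hidden in `{s,a,b,c}` / `piecePairs` being those in scope at the call site. [this work] -/
theorem p3half_of_pieces' [DecidableEq V] {ι : Type*} [Fintype ι] [DecidableEq ι] (w : Sym2 V → unitInterval)
    (hd : s ≠ a ∧ s ≠ b ∧ s ≠ c ∧ a ≠ b ∧ a ≠ c ∧ b ≠ c) (part : V → ι)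
    (hw : ∀ x y : V, x ∉ ({s, a, b, c} : Finset V) → y ∉ ({s, a, b, c} : Finset V) → part x ≠ part y → (w s(x, y) : ℝ) = 0)
    (hrow : ∀ i : ι,
      (prodBernoulli fun e => if e ∈ piecePairs {s, a, b, c} part i then w e else 0).real
          (openConn s a ∩ (openConn s b)ᶜ : Set (BondConfig V)) *
        (prodBernoulli fun e => if e ∈ piecePairs {s, a, b, c} part i then w e else 0).real
          ((openConn c s)ᶜ ∩ (openConn c a)ᶜ ∩ (openConn c b)ᶜ : Set (BondConfig V))ᶜ ≤
      2 * (prodBernoulli fun e => if e ∈ piecePairs {s, a, b, c} part i then w e else 0).real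
          (openConn s a ∩ (openConn s b)ᶜ ∩ ((openConn c s)ᶜ ∩ (openConn c a)ᶜ ∩ (openConn c b)ᶜ)ᶜ : Set (BondConfig V))) :
    (prodBernoulli w).real (openConn s a ∩ (openConn s b)ᶜ : Set (BondConfig V)) *
        (prodBernoulli w).real ((openConn c s)ᶜ ∩ (openConn c a)ᶜ ∩ (openConn c b)ᶜ : Set (BondConfig V))ᶜ ≤
      2 * (prodBernoulli w).real (openConn s a ∩ (openConn s b)ᶜ ∩ ((openConn c s)ᶜ ∩ (openConn c a)ᶜ ∩ (openConn c b)ᶜ)ᶜ : Set (BondConfig V)) := by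
  obtain rfl : ‹DecidableEq V› = fun a b => Classical.propDecidable (a = b) := Subsingleton.elim _ _
  obtain rfl : ‹DecidableEq ι› = fun a b => Classical.propDecidable (a = b) := Subsingleton.elim _ _
  exact p3half_of_pieces w hd part hw hrow

end Summit.CriticalPhenomena.PercolationContinuityZ3.Theorems.SuperTerminalP3HalfGluing
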